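import Literature.NumberTheory.GaloisRepresentations.OrdinaryPolarizedDeformationRing
import HarnessLib

/-!
# Polarized `S`-unramified deformation rings of a `GL_n`-valued residual Galois representation,
# with NO local condition at the places above `p` (interface and existence fact)

Topic `Literature/NumberTheory/GaloisRepresentations`.  The companion of
`OrdinaryPolarizedDeformationRing.lean` in which the Borel ("ordinary") clause at the places
`v ∣ p` is DELETED: the deformation problem is Mazur's "unramified outside `S`" problem for
`Π = G_{F,S}` [Maz, §1, §20 Prop. 2, §26 Prop. 1] cut down by a trace-form polarization — the
`GL_n`-shadow of CHT's `R^univ_𝒮` for the global datum `𝒮 = (F/F⁺, S, S̃, 𝒪, r̄, χ, {𝒟_v})`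
with every local deformation problem `𝒟_v`, `v ∈ S`, taken to be ALL liftings of `r̄|_{Γ_{F_v}}`
[CHT, §2.2 (Def. 2.2.1, Def. 2.2.2, `R^univ_𝒮`), §2.3].  This is ingredient (a) of the
characteristic-zero dimension count of a polarized deformation space at a de Rham point
(Kisin's generic-fibre representability is applied to `R^univ_𝒮[1/p]`), for which no condition
at `p` may be imposed in advance.

Data: a Galois extension of fields `F/F₀` with `F` a number field, a prime `p`, a rank `n`, a
coefficient ring `𝒪` (a `ℤ_p`-algebra, `𝒪 → k` onto) with residue field `k`, and a **polarized
residual datum** `𝒟 : PolarizedDatum F₀ F p n 𝒪 k`: a finite set `S ⊇ {v ∣ p}` of finite places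
of `F`; a continuous `r̄ = residual : Γ_F → GL_n(k)` unramified outside `S`; and a set
`Θ ⊆ Γ_{F₀}` with an integer `m` such that `r̄` is **polarized in trace form** along the outer
automorphisms `θ_c = absGaloisOuterConj F₀ F c`, `c ∈ Θ`: `tr r̄(θ_c σ) = ε(σ)^m · tr r̄(σ⁻¹)`,
`ε = GaloisRep.cyclotomicCharacter F p`.  Then:

* `𝒟.IsDeformation π ρ` for a `k`-augmented local `𝒪`-algebra `(A, π)` — "`ρ` is a lift of `r̄`
  of type `𝒟`": `𝔪_A`-adically continuous, `GL_n(π) ∘ ρ = r̄`, unramified outside `S`, and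
  polarized (`tr ρ(θ_c σ) = ε(σ)^m tr ρ(σ⁻¹)` in `A`); its projections; invariance under strict
  equivalence; `isDeformation_residual`;
* `𝒟.HasScalarCentralizer` (Mazur's `k ≅ End_{k[Π]}(V̄)` [Maz, §11]); `algHom_residue_unique`;
* THE INTERFACE `PolarizedDeformationRing 𝒟` — verbatim the shape of
  `OrdinaryPolarizedDeformationRing`: a complete Noetherian local `𝒪`-algebra `R` with
  augmentation onto `k`, a type-`𝒟` lift `ρ`, universal among type-`𝒟` lifts to complete
  Noetherian local `𝒪`-algebras with residue field `k` up to strict equivalence;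
* THE CONSTRUCTION as a named fact `polarizedDeformationRing_nonempty` (proved in the companion
  `PolarizedDeformationRingProofs.lean`: `polarizedDeformationRing_nonempty_holds`);
* the FORGETFUL BRIDGE from the ordinary polarized datum: `OrdinaryPolarizedDatum.toPolarized`
  (drop the frames), `OrdinaryPolarizedDatum.IsDeformation.toPolarized` (an ordinary polarized
  type-`𝒟` lift is a polarized type-`𝒟.toPolarized` lift), and `hasScalarCentralizer_toPolarized`;
* `HasScalarCentralizer` is a genuine hypothesis (`not_forall_hasScalarCentralizer`, transported
  from the ordinary file's trivial datum).

## Design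

Conventions are those of the ordinary file (augmentations `π : A →ₐ[𝒪] k`, algebraic
continuity, bare homomorphisms `Γ_F →* GL_n(A)`, all carrier types in `Type`).  With no local
condition at `p`, "of type `𝒟`" is visibly closed under morphisms, fibre products and injections
[Maz, §23 (1)–(3)] (the polarization identities are equations in `A`), and the representability
on `Ĉ_𝒪(k)` is [Maz, §20 Prop. 2] for `Π = G_{F,S}` (which satisfies `Φ_p`, [Maz, §1]) under
`k ≅ End_{k[Π]}(V̄)` [Maz, §11 Prop.]; NO distinguishedness hypothesis at `v ∣ p` is needed (there
is no flag to pin).  NOT here: framed deformations and `𝒢_n`-valued polarizations [CHT, §2.2];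
tangent spaces and the Poitou–Tate / Greenberg–Wiles count [Maz, §26 Prop. 2]; Kisin's
generic-fibre representability.

## References

* [Maz] B. Mazur, *An introduction to the deformation theory of Galois representations*, in
  Modular Forms and Fermat's Last Theorem (Springer 1997), §1, §10–§12, §20 Prop. 1–2, §23,
  §26 Prop. 1. [cite: Mazur1997Deformation, §20 Prop. 2 and §26 Prop. 1]
* [CHT] L. Clozel, M. Harris, R. Taylor, *Automorphy for some `l`-adic lifts of automorphic mod
  `l` Galois representations*, Publ. Math. IHÉS 108 (2008), §2.2 (Def. 2.2.1, Def. 2.2.2,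
  `R^univ_𝒮`), §2.3. [cite: ClozelHarrisTaylor2008, §2.2]
-/

noncomputable section

open scoped NumberField
open Field IsDedekindDomain Matrix

namespace Literature.NumberTheory.GaloisRepresentations

/-! ### The residual datum -/

/-- A **polarized residual datum** `𝒟` of rank `n` for `F/F₀`, `p` and the coefficient ring `𝒪`
with residue field `k` — an `OrdinaryPolarizedDatum` WITHOUT the residual frames at `v ∣ p`:
`𝒪 → k` onto; a finite set `S ⊇ {v ∣ p}` of finite places of `F`; a continuous residual
representation `r̄ = residual : Γ_F → GL_n(k)` (open kernel) unramified outside `S`; and a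
trace-form polarization already satisfied by `r̄`: `tr r̄(θ_c σ) = ε(σ)^m tr r̄(σ⁻¹)` for the
outer automorphisms `θ_c`, `c ∈ Θ ⊆ Γ_{F₀}`.  Compare CHT's global data
`(F/F⁺, S, S̃, 𝒪, r̄, χ, {𝒟_v})` with unrestricted `𝒟_v`. [cite: ClozelHarrisTaylor2008, §2.3] -/
structure PolarizedDatum (F₀ F : Type) [Field F₀] [Field F] [NumberField F]
    [Algebra F₀ F] [IsGalois F₀ F] (p n : ℕ) [Fact p.Prime] (𝒪 : Type) [CommRing 𝒪] [Algebra ℤ_[p] 𝒪]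
    (k : Type) [Field k] [Algebra 𝒪 k] where
  /-- `𝒪 → k` is onto: `k` is the residue field of the coefficient ring. -/
  residueMap_surjective : Function.Surjective (algebraMap 𝒪 k)
  /-- The finite set `S` of finite places where ramification is allowed. -/
  S : Set (HeightOneSpectrum (𝓞 F))
  /-- `S` is finite. -/
  S_finite : S.Finite
  /-- `S` contains every place above `p`. -/
  mem_S_of_mem : ∀ v : HeightOneSpectrum (𝓞 F), (p : 𝓞 F) ∈ v.asIdeal → v ∈ S
  /-- The residual representation `r̄ : Γ_F → GL_n(k)`. -/
  residual : absoluteGaloisGroup F →* GL (Fin n) k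
  /-- `r̄` is continuous for the discrete topology on `k`. -/
  isOpen_ker_residual : IsOpen ((residual.ker : Set (absoluteGaloisGroup F)))
  /-- `r̄` is unramified outside `S`. -/
  residual_unramified : ∀ v ∉ S, Deformation.IsUnramifiedAt v residual
  /-- The conjugations `c ∈ Γ_{F₀}` along which the polarization is imposed. -/
  Θ : Set (absoluteGaloisGroup F₀)
  /-- The multiplier exponent: `r̄^c ≅ r̄^∨ ⊗ ε^m` in trace form. -/
  m : ℤ
  /-- `r̄` is polarized: `tr r̄(θ_c σ) = ε(σ)^m · tr r̄(σ⁻¹)`. -/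
  residual_polarized : ∀ c ∈ Θ, ∀ σ, (residual (absGaloisOuterConj F₀ F c σ)).val.trace =
    algebraMap 𝒪 k (algebraMap ℤ_[p] 𝒪 (((GaloisRep.cyclotomicCharacter F p σ) ^ m : ℤ_[p]ˣ) : ℤ_[p])) *
      (residual σ⁻¹).val.trace

namespace PolarizedDatum

variable {F₀ F : Type} [Field F₀] [Field F] [NumberField F] [Algebra F₀ F] [IsGalois F₀ F]
  {p n : ℕ} [Fact p.Prime] {𝒪 : Type} [CommRing 𝒪] [Algebra ℤ_[p] 𝒪] {k : Type} [Field k] [Algebra 𝒪 k]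
  (𝒟 : PolarizedDatum F₀ F p n 𝒪 k)

/-- **`ρ : Γ_F → GL_n(A)` is a lift of `r̄` of type `𝒟`** to the `k`-augmented local `𝒪`-algebra
`(A, π)`: `𝔪_A`-adically continuous; `GL_n(π) ∘ ρ = r̄`; unramified outside `S`; and
**polarized**: `tr ρ(θ_c σ) = ε(σ)^m · tr ρ(σ⁻¹)` in `A` for all `c ∈ Θ`.  NO condition at the
places above `p`.  Deformations of type `𝒟` are such lifts up to `Deformation.IsStrictEquiv`.
[cite: ClozelHarrisTaylor2008, Def. 2.2.1] -/
def IsDeformation {A : Type} [CommRing A] [IsLocalRing A] [Algebra 𝒪 A] (π : A →ₐ[𝒪] k)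
    (ρ : absoluteGaloisGroup F →* GL (Fin n) A) : Prop :=
  Deformation.IsAdicContinuous ρ ∧
  (Matrix.GeneralLinearGroup.map (π : A →+* k)).comp ρ = 𝒟.residual ∧
  (∀ v ∉ 𝒟.S, Deformation.IsUnramifiedAt v ρ) ∧
  (∀ c ∈ 𝒟.Θ, ∀ σ, (ρ (absGaloisOuterConj F₀ F c σ)).val.trace =
    algebraMap 𝒪 A (algebraMap ℤ_[p] 𝒪 (((GaloisRep.cyclotomicCharacter F p σ) ^ 𝒟.m : ℤ_[p]ˣ) : ℤ_[p])) *
      (ρ σ⁻¹).val.trace)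

/-- **Mazur's representability hypothesis** "the natural mapping `k → End_{k[Π]}(V̄)` is an
isomorphism", in matrix form: every matrix commuting with all `r̄(γ)` is a scalar (holds for
absolutely irreducible `r̄` by Schur).  A HYPOTHESIS on the datum, assumed by
`polarizedDeformationRing_nonempty` — not a result. [cite: Mazur1997Deformation, §11] -/
def HasScalarCentralizer (𝒟 : PolarizedDatum F₀ F p n 𝒪 k) : Prop :=
  ∀ M : Matrix (Fin n) (Fin n) k, (∀ γ, M * (𝒟.residual γ).val = (𝒟.residual γ).val * M) →
    ∃ c : k, M = c • (1 : Matrix (Fin n) (Fin n) k)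

variable {𝒟}

section API

variable {A : Type} [CommRing A] [IsLocalRing A] [Algebra 𝒪 A] {π : A →ₐ[𝒪] k}
  {ρ ρ' : absoluteGaloisGroup F →* GL (Fin n) A}

/-- A type-`𝒟` lift is `𝔪_A`-adically continuous. [folklore] -/
theorem IsDeformation.isAdicContinuous (h : 𝒟.IsDeformation π ρ) : Deformation.IsAdicContinuous ρ :=
  h.1

/-- A type-`𝒟` lift reduces to `r̄`: `GL_n(π) ∘ ρ = r̄`. [folklore] -/
theorem IsDeformation.residual_eq (h : 𝒟.IsDeformation π ρ) :
    (Matrix.GeneralLinearGroup.map (π : A →+* k)).comp ρ = 𝒟.residual := h.2.1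

/-- A type-`𝒟` lift is unramified outside `S`. [folklore] -/
theorem IsDeformation.unramified (h : 𝒟.IsDeformation π ρ) : ∀ v ∉ 𝒟.S, Deformation.IsUnramifiedAt v ρ :=
  h.2.2.1

/-- A type-`𝒟` lift is polarized: `tr ρ(θ_c σ) = ε(σ)^m · tr ρ(σ⁻¹)`. [folklore] -/
theorem IsDeformation.polarized (h : 𝒟.IsDeformation π ρ) :
    ∀ c ∈ 𝒟.Θ, ∀ σ, (ρ (absGaloisOuterConj F₀ F c σ)).val.trace =
      algebraMap 𝒪 A (algebraMap ℤ_[p] 𝒪 (((GaloisRep.cyclotomicCharacter F p σ) ^ 𝒟.m : ℤ_[p]ˣ) : ℤ_[p])) *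
        (ρ σ⁻¹).val.trace := h.2.2.2

/-- **"Of type `𝒟`" is a property of deformations**: it is invariant under strict equivalence
(conjugation by `P ≡ 1 mod 𝔪_A`; traces are class functions).
[cite: ClozelHarrisTaylor2008, Def. 2.2.2] -/
theorem IsDeformation.of_isStrictEquiv (h : 𝒟.IsDeformation π ρ)
    (e : Deformation.IsStrictEquiv (π : A →+* k) ρ ρ') : 𝒟.IsDeformation π ρ' := by
  obtain ⟨P, hP, hρ⟩ := e
  refine ⟨fun l => ?_, ?_, fun v hv 𝔓 h𝔓 σ hσ => ?_, fun c hc σ => ?_⟩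
  · have hker : ((Matrix.GeneralLinearGroup.map (Ideal.Quotient.mk (IsLocalRing.maximalIdeal A ^ l))).comp ρ').ker =
        ((Matrix.GeneralLinearGroup.map (Ideal.Quotient.mk (IsLocalRing.maximalIdeal A ^ l))).comp ρ).ker := by
      ext γ
      simp only [MonoidHom.mem_ker, MonoidHom.comp_apply, hρ γ, map_mul, map_inv]
      rw [mul_inv_eq_one, mul_eq_left]
    rw [hker]
    exact h.isAdicContinuous l
  · refine MonoidHom.ext fun γ => ?_
    have hγ := DFunLike.congr_fun h.residual_eq γ
    simp only [MonoidHom.comp_apply] at hγ ⊢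
    rw [hρ γ, map_mul, map_mul, map_inv, hP, hγ, one_mul, inv_one, mul_one]
  · rw [hρ σ, h.unramified v hv 𝔓 h𝔓 σ hσ, mul_one, mul_inv_cancel]
  · rw [hρ, hρ, Units.val_mul, Units.val_mul, Matrix.trace_units_conj, Units.val_mul,
      Units.val_mul, Matrix.trace_units_conj]
    exact h.polarized c hc σ

end API

/-- **`(k, r̄)` is of type `𝒟`**: the residual representation is a type-`𝒟` lift of itself to
`(k, id)` — "a deformation condition contains `(k, V̄)`". [cite: ClozelHarrisTaylor2008, Def. 2.2.2] -/
theorem isDeformation_residual (𝒟 : PolarizedDatum F₀ F p n 𝒪 k) :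
    𝒟.IsDeformation (AlgHom.id 𝒪 k) 𝒟.residual := by
  have hid : ((AlgHom.id 𝒪 k : k →ₐ[𝒪] k) : k →+* k) = RingHom.id k := rfl
  refine ⟨Deformation.isAdicContinuous_of_isOpen_ker 𝒟.isOpen_ker_residual, ?_,
    𝒟.residual_unramified, 𝒟.residual_polarized⟩
  rw [hid, Matrix.GeneralLinearGroup.map_id]
  rfl

/-- **Augmentations are unique**: since `𝒪 → k` is onto, a local `𝒪`-algebra admits at most one
`𝒪`-algebra map onto `k`. [cite: Mazur1997Deformation, §10] -/
theorem algHom_residue_unique (𝒟 : PolarizedDatum F₀ F p n 𝒪 k) {B : Type*} [CommRing B]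
    [IsLocalRing B] [Algebra 𝒪 B] (f g : B →ₐ[𝒪] k) : f = g := by
  have hsurj : ∀ e : B →ₐ[𝒪] k, Function.Surjective e := fun e x => by
    obtain ⟨o, rfl⟩ := 𝒟.residueMap_surjective x
    exact ⟨algebraMap 𝒪 B o, e.commutes o⟩
  have hf := IsLocalRing.ker_eq_maximalIdeal (f : B →+* k) (hsurj f)
  have hg := IsLocalRing.ker_eq_maximalIdeal (g : B →+* k) (hsurj g)
  ext b
  obtain ⟨o, ho⟩ := 𝒟.residueMap_surjective (f b)
  have hb : b - algebraMap 𝒪 B o ∈ RingHom.ker (f : B →+* k) := by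
    rw [RingHom.mem_ker, RingHom.coe_coe, map_sub, AlgHom.commutes, ho, sub_self]
  rw [hf, ← hg, RingHom.mem_ker, RingHom.coe_coe, map_sub, AlgHom.commutes, sub_eq_zero] at hb
  rw [hb, ho]

end PolarizedDatum

/-! ### The interface: a universal polarized deformation ring -/

/-- **A universal deformation ring of type `𝒟`** (CHT's `R^univ_𝒮` with unrestricted local
problems, Mazur's `R(Π, S; r̄)` cut by the polarization) as an INTERFACE, verbatim the shape of
`OrdinaryPolarizedDeformationRing`: a complete Noetherian local `𝒪`-algebra `R` with an
augmentation `π : R →ₐ[𝒪] k` ONTO `k`, a lift `ρ : Γ_F → GL_n(R)` of type `𝒟`, and the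
UNIVERSAL PROPERTY: for every complete Noetherian local `𝒪`-algebra `A : Type` with augmentation
`πA` onto `k` and every type-`𝒟` lift `ρA` there is a unique `𝒪`-algebra map `φ : R → A` with
`φ ∘ ρ` strictly equivalent to `ρA`.  Existence is the named fact
`polarizedDeformationRing_nonempty`. [cite: ClozelHarrisTaylor2008, §2.2] -/
structure PolarizedDeformationRing {F₀ F : Type} [Field F₀] [Field F] [NumberField F]
    [Algebra F₀ F] [IsGalois F₀ F] {p n : ℕ} [Fact p.Prime] {𝒪 : Type} [CommRing 𝒪] [Algebra ℤ_[p] 𝒪]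
    {k : Type} [Field k] [Algebra 𝒪 k] (𝒟 : PolarizedDatum F₀ F p n 𝒪 k) : Type 1 where
  /-- The underlying ring `R`. -/
  R : Type
  /-- `R` is a commutative ring. -/
  [instCommRing : CommRing R]
  /-- `R` is local. -/
  [instIsLocalRing : IsLocalRing R]
  /-- `R` is Noetherian. -/
  [instIsNoetherianRing : IsNoetherianRing R]
  /-- `R` is an `𝒪`-algebra. -/
  [instAlgebra : Algebra 𝒪 R]
  /-- `R` is `𝔪_R`-adically complete. -/
  [instIsAdicComplete : IsAdicComplete (IsLocalRing.maximalIdeal R) R]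
  /-- The augmentation `R → k` (an `𝒪`-algebra map). -/
  π : R →ₐ[𝒪] k
  /-- The augmentation is onto: `R/𝔪_R = k`. -/
  π_surjective : Function.Surjective π
  /-- The universal representation `ρ^univ : Γ_F → GL_n(R)`. -/
  ρ : absoluteGaloisGroup F →* GL (Fin n) R
  /-- `ρ^univ` is a lift of type `𝒟`. -/
  isDeformation : 𝒟.IsDeformation π ρ
  /-- Universality among type-`𝒟` lifts to complete Noetherian local `𝒪`-algebras with residue
  field `k`, up to strict equivalence. -/
  universal : ∀ (A : Type) [CommRing A] [IsLocalRing A] [IsNoetherianRing A] [Algebra 𝒪 A]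
    [IsAdicComplete (IsLocalRing.maximalIdeal A) A] (πA : A →ₐ[𝒪] k),
    Function.Surjective πA → ∀ ρA : absoluteGaloisGroup F →* GL (Fin n) A, 𝒟.IsDeformation πA ρA →
    ∃! φ : R →ₐ[𝒪] A,
      Deformation.IsStrictEquiv (πA : A →+* k) ((Matrix.GeneralLinearGroup.map (φ : R →+* A)).comp ρ) ρA

namespace PolarizedDeformationRing

attribute [instance] instCommRing instIsLocalRing instIsNoetherianRing instAlgebra
  instIsAdicComplete

variable {F₀ F : Type} [Field F₀] [Field F] [NumberField F] [Algebra F₀ F] [IsGalois F₀ F]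
  {p n : ℕ} [Fact p.Prime] {𝒪 : Type} [CommRing 𝒪] [Algebra ℤ_[p] 𝒪] {k : Type} [Field k] [Algebra 𝒪 k]
  {𝒟 : PolarizedDatum F₀ F p n 𝒪 k} (𝓡 : PolarizedDeformationRing 𝒟)

/-- The kernel of the augmentation is the maximal ideal: `R/𝔪_R = k`. [folklore] -/
theorem ker_π : RingHom.ker (𝓡.π : 𝓡.R →+* k) = IsLocalRing.maximalIdeal 𝓡.R :=
  IsLocalRing.ker_eq_maximalIdeal _ 𝓡.π_surjective

/-- Every `𝒪`-algebra map `φ : R → A` to a `k`-augmented local `𝒪`-algebra is compatible with the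
augmentations, `πA ∘ φ = π`. [cite: Mazur1997Deformation, §10] -/
theorem augmentation_comp {A : Type*} [CommRing A] [IsLocalRing A] [Algebra 𝒪 A]
    (πA : A →ₐ[𝒪] k) (φ : 𝓡.R →ₐ[𝒪] A) : πA.comp φ = 𝓡.π :=
  𝒟.algHom_residue_unique _ _

/-- … and is a local homomorphism (`φ(𝔪_R) ⊆ 𝔪_A`) as soon as `πA` is onto.
[cite: Mazur1997Deformation, §2] -/
theorem isLocalHom_algHom {A : Type*} [CommRing A] [IsLocalRing A] [Algebra 𝒪 A]
    (πA : A →ₐ[𝒪] k) (hπA : Function.Surjective πA) (φ : 𝓡.R →ₐ[𝒪] A) :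
    IsLocalHom (φ : 𝓡.R →+* A) := by
  refine ⟨fun r hr => ?_⟩
  by_contra hru
  have hrm : r ∈ IsLocalRing.maximalIdeal 𝓡.R := hru
  have hφr : φ r ∈ IsLocalRing.maximalIdeal A := by
    rw [← IsLocalRing.ker_eq_maximalIdeal (πA : A →+* k) hπA, RingHom.mem_ker, RingHom.coe_coe,
      ← AlgHom.comp_apply, 𝓡.augmentation_comp πA φ]
    rw [← 𝓡.ker_π, RingHom.mem_ker, RingHom.coe_coe] at hrm
    exact hrm
  exact hφr hr

end PolarizedDeformationRing

/-! ### The construction, as a named fact -/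

/-- **Existence of the universal polarized `S`-unramified deformation ring** (named fact; proved
in `PolarizedDeformationRingProofs.lean` as `polarizedDeformationRing_nonempty_holds`).  Let `k` be
a finite field of characteristic `p`, `𝒪` a complete Noetherian local `ℤ_p`-algebra with residue
field `k`, `F/F₀` Galois with `F` a number field, and `𝒟` a polarized residual datum of rank `n`
whose `r̄` has scalar centralizer ("`k ≅ End_{k[Π]}(V̄)`").  Then type-`𝒟` deformations admit a
universal ring on complete Noetherian local `𝒪`-algebras with residue field `k`:
`Nonempty (PolarizedDeformationRing 𝒟)`.  Printed ingredients: `Π = G_{F,S}` satisfies `Φ_p`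
[Maz, §1]; "the representability proposition … is valid in this context" for
`k ≅ End_{k[Π]}(V̄)` [Maz, §11 Prop., §20 Prop. 2]; "given a Global Galois deformation problem,
the full subcategory … defines a deformation condition for `G_{K,S}`" [Maz, §26 Prop. 1]; the
trace polarization is a closed condition (cf. [CHT, §2.2–2.3], where `R^univ_𝒮` is constructed
for arbitrary local deformation problems `𝒟_v`, in particular the unrestricted ones).  No
hypothesis at the places above `p`.
[cite: Mazur1997Deformation, §20 Prop. 2 and §26 Prop. 1] [cite: ClozelHarrisTaylor2008, §2.2] -/
def polarizedDeformationRing_nonempty : Prop :=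
  ∀ (F₀ F : Type) [Field F₀] [Field F] [NumberField F] [Algebra F₀ F] [IsGalois F₀ F]
    (p n : ℕ) [Fact p.Prime] (𝒪 : Type) [CommRing 𝒪] [IsLocalRing 𝒪] [IsNoetherianRing 𝒪]
    [IsAdicComplete (IsLocalRing.maximalIdeal 𝒪) 𝒪] [Algebra ℤ_[p] 𝒪]
    (k : Type) [Field k] [Finite k] [CharP k p] [Algebra 𝒪 k]
    (𝒟 : PolarizedDatum F₀ F p n 𝒪 k),
    𝒟.HasScalarCentralizer → Nonempty (PolarizedDeformationRing 𝒟)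

/-! ### The forgetful bridge from the ordinary polarized datum -/

namespace OrdinaryPolarizedDatum

variable {F₀ F : Type} [Field F₀] [Field F] [NumberField F] [Algebra F₀ F] [IsGalois F₀ F]
  {p n : ℕ} [Fact p.Prime] {𝒪 : Type} [CommRing 𝒪] [Algebra ℤ_[p] 𝒪] {k : Type} [Field k] [Algebra 𝒪 k]

/-- **Forget the frames**: an ordinary polarized residual datum has an underlying polarized
residual datum (same `S`, `r̄`, `Θ`, `m`). [folklore] -/
def toPolarized (𝒟 : OrdinaryPolarizedDatum F₀ F p n 𝒪 k) : PolarizedDatum F₀ F p n 𝒪 k where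
  residueMap_surjective := 𝒟.residueMap_surjective
  S := 𝒟.S
  S_finite := 𝒟.S_finite
  mem_S_of_mem := 𝒟.mem_S_of_mem
  residual := 𝒟.residual
  isOpen_ker_residual := 𝒟.isOpen_ker_residual
  residual_unramified := 𝒟.residual_unramified
  Θ := 𝒟.Θ
  m := 𝒟.m
  residual_polarized := 𝒟.residual_polarized

/-- The underlying polarized datum has the same residual representation. [folklore] -/
@[simp] theorem toPolarized_residual (𝒟 : OrdinaryPolarizedDatum F₀ F p n 𝒪 k) :
    𝒟.toPolarized.residual = 𝒟.residual := rfl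

/-- The underlying polarized datum has the same ramification set. [folklore] -/
@[simp] theorem toPolarized_S (𝒟 : OrdinaryPolarizedDatum F₀ F p n 𝒪 k) : 𝒟.toPolarized.S = 𝒟.S := rfl

/-- **An ordinary polarized type-`𝒟` lift is a polarized type-`𝒟.toPolarized` lift** (drop the
Borel clause): the ordinary polarized problem is a SUBFUNCTOR of the polarized one, so that —
once both are representable — `R^{ord,pol}` is a quotient of `R^{pol}`.
[cite: Mazur1997Deformation, §23] -/
theorem IsDeformation.toPolarized {𝒟 : OrdinaryPolarizedDatum F₀ F p n 𝒪 k} {A : Type} [CommRing A]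
    [IsLocalRing A] [Algebra 𝒪 A] {π : A →ₐ[𝒪] k} {ρ : absoluteGaloisGroup F →* GL (Fin n) A}
    (h : 𝒟.IsDeformation π ρ) : 𝒟.toPolarized.IsDeformation π ρ :=
  ⟨h.isAdicContinuous, h.residual_eq, h.unramified, h.polarized⟩

/-- The scalar-centralizer hypothesis does not see the frames. [folklore] -/
theorem hasScalarCentralizer_toPolarized (𝒟 : OrdinaryPolarizedDatum F₀ F p n 𝒪 k) :
    𝒟.toPolarized.HasScalarCentralizer ↔ 𝒟.HasScalarCentralizer := Iff.rfl

end OrdinaryPolarizedDatum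

/-! ### `HasScalarCentralizer` is a hypothesis on the datum, not a theorem -/

namespace PolarizedDatum

variable {F₀ F : Type} [Field F₀] [Field F] [NumberField F] [Algebra F₀ F] [IsGalois F₀ F]
  {p n : ℕ} [Fact p.Prime] {𝒪 : Type} [CommRing 𝒪] [Algebra ℤ_[p] 𝒪] {k : Type} [Field k] [Algebra 𝒪 k]

/-- **Schur's Lemma, Burnside form** [Maz, §4 Cor.]: if the matrices `r̄(γ)` span `M_n(k)` (e.g.
`r̄` absolutely irreducible, [Maz, §4 Prop.]), a matrix commuting with every `r̄(γ)` commutes with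
all of `M_n(k)`, hence is scalar (Mathlib's `Matrix.mem_range_scalar_iff_commute_single'`).
[cite: Mazur1997Deformation, §4 Cor.] -/
theorem hasScalarCentralizer_of_span_eq_top (𝒟 : PolarizedDatum F₀ F p n 𝒪 k)
    (h : Submodule.span k (Set.range fun γ => (𝒟.residual γ : Matrix (Fin n) (Fin n) k)) = ⊤) :
    𝒟.HasScalarCentralizer := by
  intro M hM
  have hall : ∀ X : Matrix (Fin n) (Fin n) k, M * X = X * M := by
    intro X
    have hX : X ∈ Submodule.span k (Set.range fun γ => (𝒟.residual γ : Matrix (Fin n) (Fin n) k)) := by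
      rw [h]
      exact Submodule.mem_top
    refine Submodule.span_induction (p := fun X _ => M * X = X * M) ?_ ?_ ?_ ?_ hX
    · rintro _ ⟨γ, rfl⟩
      exact hM γ
    · rw [mul_zero, zero_mul]
    · intro X Y _ _ hX hY
      rw [mul_add, add_mul, hX, hY]
    · intro c X _ hX
      rw [mul_smul_comm, smul_mul_assoc, hX]
  obtain ⟨c, hc⟩ := Matrix.mem_range_scalar_iff_commute_single'.mpr fun i j => (hall (Matrix.single i j 1)).symm
  exact ⟨c, by rw [← hc, Matrix.scalar_apply, Matrix.smul_one_eq_diagonal]⟩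

/-- … but it is a genuine CONDITION on `𝒟` [Maz, §11]: in rank `n ≥ 2` over every base with
`𝒪 → k` onto, the trivial datum (forgetful image of the ordinary file's
`OrdinaryPolarizedDatum.exists_residual_eq_one`) violates it, so the universal closure
`∀ 𝒟, 𝒟.HasScalarCentralizer` is false. [cite: Mazur1997Deformation, §11] -/
theorem not_forall_hasScalarCentralizer (hk : Function.Surjective (algebraMap 𝒪 k)) (hn : 2 ≤ n) :
    ¬ ∀ 𝒟 : PolarizedDatum F₀ F p n 𝒪 k, 𝒟.HasScalarCentralizer := by
  obtain ⟨𝒟, h𝒟⟩ := OrdinaryPolarizedDatum.exists_residual_eq_one (F₀ := F₀) (F := F) (p := p) (n := n)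
    (𝒪 := 𝒪) (k := k) hk
  exact fun h => 𝒟.not_hasScalarCentralizer_of_residual_eq_one hn h𝒟
    ((OrdinaryPolarizedDatum.hasScalarCentralizer_toPolarized 𝒟).1 (h 𝒟.toPolarized))

/-- A fully explicit instance: rank `2` over `F = F₀ = ℚ`, `𝒪 = ℤ_p`, `k = ℤ_p/(p)`.
[cite: Mazur1997Deformation, §11] -/
theorem not_forall_hasScalarCentralizer_rat (p : ℕ) [Fact p.Prime] :
    ¬ ∀ 𝒟 : PolarizedDatum ℚ ℚ p 2 ℤ_[p] (IsLocalRing.ResidueField ℤ_[p]), 𝒟.HasScalarCentralizer :=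
  not_forall_hasScalarCentralizer
    (by rw [IsLocalRing.ResidueField.algebraMap_eq]; exact IsLocalRing.residue_surjective) le_rfl

end PolarizedDatum

end Literature.NumberTheory.GaloisRepresentations
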